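import Mathlib
import Literature.Combinatorics.Additive.TripleProductProperty
import Summits.MatrixMultiplication.MatrixMultiplication.Theorems.SnSubsetDichotomyThresholdSubsetTriplesStubTppOfTwistFree

/-!
# `SnSubsetDichotomy.ThresholdSubsetTriples`, line `SketchIdeator2` — stub `twistFree_iff_tpp`

The triality lever of the ℤ/3-symmetric line of crux `stmt-MatrixMultiplication-10882`, as an
*equivalence*: for an element `γ` of a group with `γ³ = 1` and a finite set `X`, the twisted corner
equation `a a'⁻¹ · γ · b b'⁻¹ · γ · c c'⁻¹ · γ = 1` has only the trivial solutions in `X` if and only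
if the triple `(X, γXγ⁻¹, γ²Xγ⁻²)` has the triple product property
(`Literature.Combinatorics.Additive.TripleProductProperty`, Cohn–Umans 2003, Def. 2.1).

The forward direction is the landed `TppOfTwistFree.tpp_of_twist`.  For the converse, a twisted
corner `a a'⁻¹ γ (b b'⁻¹) γ (c c'⁻¹) γ = 1` of `X` gives the TPP relation of the triple with
`s = a`, `s' = a'`, `t = γbγ⁻¹`, `t' = γb'γ⁻¹`, `u = γ²cγ⁻²`, `u' = γ²c'γ⁻²`, by the group identity
`s s'⁻¹ · t t'⁻¹ · u u'⁻¹ = (a a'⁻¹ γ (b b'⁻¹) γ (c c'⁻¹) γ) · (γ³)⁻¹`; the TPP then forces `a = a'`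
and, after cancelling the conjugations, `b = b'`, `c = c'`.
-/

namespace Summit.MatrixMultiplication.MatrixMultiplication.Theorems.ThresholdSubsetTriples

open Literature.Combinatorics.Additive

set_option linter.dupNamespace false in -- deliberate `Summit.<S>.<P>` duplicate
/-- **Stub `twistFree_iff_tpp` (the triality lever as an equivalence)** (line `SketchIdeator2` of
crux `SnSubsetDichotomy.ThresholdSubsetTriples`, stmt-MatrixMultiplication-10882).  If `γ³ = 1`,
then the finite set `X` has only trivial twisted corners
(`a a'⁻¹ γ (b b'⁻¹) γ (c c'⁻¹) γ = 1 ⟹ a = a', b = b', c = c'`) if and only if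
`(X, γXγ⁻¹, γ²Xγ⁻²)` has the triple product property.  Forward: `TppOfTwistFree.tpp_of_twist`;
converse: a twisted corner is, up to the factor `(γ³)⁻¹ = 1`, a TPP relation of the triple with
`t = γbγ⁻¹`, `t' = γb'γ⁻¹`, `u = γ²cγ⁻²`, `u' = γ²c'γ⁻²`, and conjugation is injective. [folklore] -/
theorem twistFree_iff_tpp {G : Type*} [Group G] [DecidableEq G] (X : Finset G) (γ : G)
    (hγ : γ ^ 3 = 1) :
    (∀ a ∈ X, ∀ a' ∈ X, ∀ b ∈ X, ∀ b' ∈ X, ∀ c ∈ X, ∀ c' ∈ X,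
      a * a'⁻¹ * γ * (b * b'⁻¹) * γ * (c * c'⁻¹) * γ = 1 → a = a' ∧ b = b' ∧ c = c') ↔
    TripleProductProperty X (X.image (fun x => γ * x * γ⁻¹))
      (X.image (fun x => γ ^ 2 * x * (γ ^ 2)⁻¹)) := by
  refine ⟨TppOfTwistFree.tpp_of_twist X γ hγ, fun htpp => ?_⟩
  intro a ha a' ha' b hb b' hb' c hc c' hc' hcorner
  -- the twisted corner is a TPP relation of the twisted triple, up to the factor `(γ³)⁻¹ = 1`
  have key : a * a'⁻¹ * (γ * b * γ⁻¹ * (γ * b' * γ⁻¹)⁻¹) *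
      (γ ^ 2 * c * (γ ^ 2)⁻¹ * (γ ^ 2 * c' * (γ ^ 2)⁻¹)⁻¹) = 1 := by
    calc a * a'⁻¹ * (γ * b * γ⁻¹ * (γ * b' * γ⁻¹)⁻¹) *
          (γ ^ 2 * c * (γ ^ 2)⁻¹ * (γ ^ 2 * c' * (γ ^ 2)⁻¹)⁻¹)
        = (a * a'⁻¹ * γ * (b * b'⁻¹) * γ * (c * c'⁻¹) * γ) * (γ ^ 3)⁻¹ := by group
      _ = 1 := by rw [hcorner, hγ, inv_one, one_mul]
  obtain ⟨h1, h2, h3⟩ := htpp a ha a' ha' (γ * b * γ⁻¹) (Finset.mem_image_of_mem _ hb)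
    (γ * b' * γ⁻¹) (Finset.mem_image_of_mem _ hb') (γ ^ 2 * c * (γ ^ 2)⁻¹)
    (Finset.mem_image_of_mem _ hc) (γ ^ 2 * c' * (γ ^ 2)⁻¹) (Finset.mem_image_of_mem _ hc') key
  exact ⟨h1, mul_left_cancel (mul_right_cancel h2), mul_left_cancel (mul_right_cancel h3)⟩

end Summit.MatrixMultiplication.MatrixMultiplication.Theorems.ThresholdSubsetTriples
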